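import Literature.AlgebraicTopology.SingularHomology.KroneckerCrossProduct
import HarnessLib

/-!
# `⟨pr₁^*α ⌣ pr₂^*β, x × y⟩ = ⟨α, x⟩ ⟨β, y⟩` in all degrees for classes with normalised representatives

Topic `Literature/AlgebraicTopology/SingularHomology`; sequel of `KroneckerCrossProduct.lean` (the case
`β ∈ H¹`). The labels `a₀ ≤ ⋯ ≤ aₙ`, `b₀ ≤ ⋯ ≤ bₙ` of a shuffle simplex
`(σ ∘ [e_{a₀}, …, e_{aₙ}], τ ∘ [e_{b₀}, …, e_{bₙ}])` of the Eilenberg–Zilber product `σ × τ` are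
MONOTONE (`ShuffleChains.monotone_frontLabels`, `…monotone_backLabels`), so a cochain need only vanish
on DEGENERATE simplices — reparametrisations `ρ ∘ [e_{u₀}, …, e_{u_l}]` along a monotone non-injective
`u` — for the classical computation "Alexander–Whitney ∘ Eilenberg–Zilber = 1 modulo degeneracies"
(Eilenberg–Mac Lane 1953, Thm. 2.1a; Hatcher, *Algebraic Topology* (2002), §3.B pp. 278–279) to apply
to it. Such **normalised cochains** (`IsWeaklyNormalizedCochain`) are stable under the cup product
(`IsWeaklyNormalizedCochain.cochainCup`: a monotone label map with a repetition repeats two CONSECUTIVE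
labels, which fall into the front face or into the back face) and under pull-back, and every
`1`-cocycle is normalised (it vanishes on constant simplices). Consequently every cup monomial of
degree-one classes has a normalised representative (`HasNormalizedRep.cupProduct`,
`hasNormalizedRep_of_one`), and for classes `α ∈ Hᵏ(X; R)`, `β ∈ Hˡ(Y; R)` with normalised
representatives and `x ∈ Hₚ(X; R)`, `y ∈ H_q(Y; R)`, `k + l = p + q = n`:

* `kroneckerPairing_cupProduct_cross_of_hasNormalizedRep` (matched degrees `k = p`, `l = q`):
  **`⟨pr₁^*α ⌣ pr₂^*β, x × y⟩ = ⟨α, x⟩ · ⟨β, y⟩`** (Hatcher 2002, §3.B p. 279: "`(φ × ψ)(eᵢ × eⱼ) = φ(eᵢ)ψ(eⱼ)`");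
* `kroneckerPairing_cupProduct_cross_eq_zero_of_ne` (mismatched degrees `k ≠ p`):
  **`⟨pr₁^*α ⌣ pr₂^*β, x × y⟩ = 0`** ("the other summands vanish by Fubini's Theorem", Lange 2023,
  proof of Lemma 2.5.12, p. 133).

These are the evaluation rules behind Lange's §2.5.3 (Pontryagin product dual to the cup product,
Lemma 2.5.12 / Prop. 2.5.13) for products of arbitrary degree. Everything is proved; the only
definitions are the two predicates (with bodies); no named fact.

## References

* [HatcherAT2002] A. Hatcher, *Algebraic Topology*, CUP 2002, §3.B pp. 277–280; §3.2 pp. 206, 218–219.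
* [Lange2023AbelianVarietiesComplex] H. Lange, *Abelian Varieties over the Complex Numbers*, Springer 2023,
  §2.5.3 Lemma 2.5.12 and its proof (p. 133), Prop. 2.5.13 (p. 134).
* S. Eilenberg, S. Mac Lane, On the groups `H(Π,n)`. I, Ann. of Math. 58 (1953), Thm. 2.1a. [folklore attribution]
-/

noncomputable section

-- see "Implementation notes" in `…SingularHomology.SingularChainsConcrete`
set_option backward.isDefEq.respectTransparency false

open CategoryTheory AlgebraicTopology

universe u v

namespace Literature.AlgebraicTopology.SingularHomology

/-! ### Shuffle paths have monotone labels -/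

namespace ShuffleChains

variable {n p k l : ℕ}

/-- Along a tuple of `shuffle n p` the first coordinate is non-decreasing. [cite: HatcherAT2002, §3.B pp. 277–278] -/
theorem monotone_fst_of_mem_support_shuffle {w : Fin (n + 1) → V} (hw : w ∈ (shuffle n p).support) :
    Monotone fun i ↦ (w i).1 :=
  Fin.monotone_iff_le_succ.mpr fun j ↦ (fst_succ_le_of_mem_support_shuffle hw j).1

/-- Along a tuple of `shuffle n p` the second coordinate is non-decreasing. [cite: HatcherAT2002, §3.B pp. 277–278] -/
theorem monotone_snd_of_mem_support_shuffle {w : Fin (n + 1) → V} (hw : w ∈ (shuffle n p).support) :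
    Monotone fun i ↦ (w i).2 :=
  Fin.monotone_iff_le_succ.mpr fun j ↦ by
    have h1 := (fst_succ_le_of_mem_support_shuffle hw j).2
    have h2 := snd_succ_eq_of_mem_support_shuffle hw j
    change (w j.castSucc).2 ≤ (w j.succ).2
    omega

/-- **The front labels of a shuffle simplex are monotone.** [cite: HatcherAT2002, §3.B pp. 277–278] -/
theorem monotone_frontLabels (h : k ≤ n) {w : Fin (n + 1) → V} (hw : w ∈ (shuffle n p).support) :
    Monotone (frontLabels h w) := fun i j hij ↦
  monotone_fst_of_mem_support_shuffle hw (show Fin.castLE (by omega) i ≤ Fin.castLE (by omega) j from hij)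

/-- **The back labels of a shuffle simplex are monotone.** [cite: HatcherAT2002, §3.B pp. 277–278] -/
theorem monotone_backLabels (h : l ≤ n) {w : Fin (n + 1) → V} (hw : w ∈ (shuffle n p).support) :
    Monotone (backLabels h w) := fun i j hij ↦
  monotone_snd_of_mem_support_shuffle hw (show (⟨(i : ℕ) + (n - l), _⟩ : Fin (n + 1)) ≤ ⟨(j : ℕ) + (n - l), _⟩ by
    rw [Fin.mk_le_mk]; exact Nat.add_le_add_right hij _)

end ShuffleChains

/-! ### Normalised cochains: vanishing on degenerate affine reparametrisations -/

section Normalized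

open EilenbergZilber SingularSimplex ShuffleChains StdSimplex singularCochainComplex

variable {R : Type v} [CommRing R]
variable {X Y : Type u} [TopologicalSpace X] [TopologicalSpace Y]
variable {k l n m : ℕ}

/-- A cochain `b ∈ Cˡ(Y; R)` is **normalised** if it vanishes on every DEGENERATE affine
reparametrisation `τ ∘ [e_{u₀}, …, e_{u_l}]` — `τ` a simplex of any dimension `m`, `u` a MONOTONE
non-injective label map into `{0, …, m}` (so the simplex factors through a codegeneracy). Weaker than
`IsNormalizedCochain` (arbitrary non-injective labels) and, unlike it, stable under cup products.
[cite: HatcherAT2002, §3.B pp. 277–280] -/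
def IsWeaklyNormalizedCochain (b : SingularSimplex Y l → R) : Prop :=
  ∀ (m : ℕ) (τ : SingularSimplex Y m) (u : Fin (l + 1) → ℕ), Monotone u → (∀ j, u j ≤ m) →
    ¬Function.Injective u → b (τ.compose fun j ↦ vtx m (u j)) = 0

omit [TopologicalSpace X] in
/-- A monotone non-injective label map repeats two consecutive labels (a degenerate simplex is an
iterated degeneracy `sᵢ`). [cite: HatcherAT2002, §3.B pp. 277–278] -/
theorem exists_eq_succ_of_monotone_of_not_injective {u : Fin (l + 1) → ℕ} (hu : Monotone u)
    (hinj : ¬Function.Injective u) : ∃ i : Fin l, u i.castSucc = u i.succ := by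
  by_contra hne
  push Not at hne
  have hsm : StrictMono u := Fin.strictMono_iff_lt_succ.mpr fun i ↦
    lt_of_le_of_ne (hu (Fin.castSucc_le_succ i)) (hne i)
  exact hinj hsm.injective

/-- The zero cochain is normalised. [cite: HatcherAT2002, §3.1 p. 198] -/
theorem isWeaklyNormalizedCochain_zero : IsWeaklyNormalizedCochain (0 : SingularSimplex Y l → R) :=
  fun _ _ _ _ _ _ ↦ rfl

/-- Normalised cochains form a submodule: sums. [cite: HatcherAT2002, §3.1 p. 198] -/
theorem IsWeaklyNormalizedCochain.add {a b : SingularSimplex Y l → R} (ha : IsWeaklyNormalizedCochain a)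
    (hb : IsWeaklyNormalizedCochain b) : IsWeaklyNormalizedCochain (a + b) := fun m τ u hu hm hinj ↦ by
  rw [Pi.add_apply, ha m τ u hu hm hinj, hb m τ u hu hm hinj, add_zero]

/-- Normalised cochains form a submodule: scalar multiples. [cite: HatcherAT2002, §3.1 p. 198] -/
theorem IsWeaklyNormalizedCochain.smul {b : SingularSimplex Y l → R} (hb : IsWeaklyNormalizedCochain b) (r : R) :
    IsWeaklyNormalizedCochain (r • b) := fun m τ u hu hm hinj ↦ by
  rw [Pi.smul_apply, hb m τ u hu hm hinj, smul_zero]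

/-- **Pull-backs of normalised cochains are normalised**: `(f^♯ b)(σ ∘ [e_u]) = b((f ∘ σ) ∘ [e_u])`.
[cite: HatcherAT2002, §3.1 p. 198] -/
theorem IsWeaklyNormalizedCochain.comap (f : C(X, Y)) {b : SingularSimplex Y l → R}
    (hb : IsWeaklyNormalizedCochain b) : IsWeaklyNormalizedCochain fun σ : SingularSimplex X l ↦ b (σ.map f) :=
  fun m τ u hu hm hinj ↦ by
    change b ((τ.compose fun j ↦ vtx m (u j)).map f) = 0
    rw [← compose_map]
    exact hb m (τ.map f) u hu hm hinj

/-- The front face of an affine reparametrisation is the reparametrisation along the first labels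
(`σ|[v₀,…,vₖ]`, Hatcher's notation for the cup product). [cite: HatcherAT2002, §3.2 p. 206] -/
theorem frontFace_compose_vtx' (h : k ≤ n) (τ : SingularSimplex Y m) (u : Fin (n + 1) → ℕ) :
    (τ.compose fun j ↦ vtx m (u j)).frontFace h =
      τ.compose fun j : Fin (k + 1) ↦ vtx m (u (Fin.castLE (by omega) j)) := by
  rw [frontFace_eq_compose, compose_compose]
  congr 1
  funext j
  rw [vtx_eq_vertex (show (j : ℕ) ≤ n by omega), affComb_vertex]
  rfl

/-- The back face of an affine reparametrisation is the reparametrisation along the last labels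
(`σ|[vₖ,…,vₙ]`). [cite: HatcherAT2002, §3.2 p. 206] -/
theorem backFace_compose_vtx' (h : l ≤ n) (τ : SingularSimplex Y m) (u : Fin (n + 1) → ℕ) :
    (τ.compose fun j ↦ vtx m (u j)).backFace h =
      τ.compose fun j : Fin (l + 1) ↦ vtx m (u ⟨(j : ℕ) + (n - l), by omega⟩) := by
  rw [backFace_eq_compose, compose_compose]
  congr 1
  funext j
  rw [vtx_eq_vertex (show (j : ℕ) + (n - l) ≤ n by omega), affComb_vertex]

/-- **The cup product of normalised cochains is normalised**: a monotone label map with a repetition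
repeats two consecutive labels, which both lie among the front `k + 1` labels or both among the back
`l + 1` labels, so one of the two factors of `(a ⌣ b)(τ ∘ [e_u]) = a(front) b(back)` vanishes.
[cite: HatcherAT2002, §3.2 p. 206] -/
theorem IsWeaklyNormalizedCochain.cochainCup (h : k + l = n) {a : SingularSimplex Y k → R}
    {b : SingularSimplex Y l → R} (ha : IsWeaklyNormalizedCochain a) (hb : IsWeaklyNormalizedCochain b) :
    IsWeaklyNormalizedCochain (cochainCup h a b) := by
  intro m τ u hu hm hinj
  obtain ⟨i, hi⟩ := exists_eq_succ_of_monotone_of_not_injective hu hinj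
  rw [cochainCup_apply, frontFace_compose_vtx' (by omega) τ u, backFace_compose_vtx' (by omega) τ u]
  by_cases hik : (i : ℕ) + 1 ≤ k
  · -- the repetition is among the front labels
    rw [ha m τ _ (fun j j' hjj' ↦ hu (show Fin.castLE _ j ≤ Fin.castLE _ j' from hjj')) (fun j ↦ hm _) ?_, zero_mul]
    intro hinj'
    have := @hinj' ⟨i, by omega⟩ ⟨i + 1, by omega⟩ (by
      change u (Fin.castLE _ ⟨i, _⟩) = u (Fin.castLE _ ⟨i + 1, _⟩)
      convert hi using 2 <;> ext <;> simp)
    simp at this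
  · -- the repetition is among the back labels
    rw [hb m τ _ (fun j j' hjj' ↦ hu (by rw [Fin.mk_le_mk]; exact Nat.add_le_add_right hjj' _)) (fun j ↦ hm _) ?_,
      mul_zero]
    intro hinj'
    have hnl : n - l = k := by omega
    have := @hinj' ⟨i - k, by omega⟩ ⟨i + 1 - k, by omega⟩ (by
      change u ⟨(i : ℕ) - k + (n - l), _⟩ = u ⟨(i : ℕ) + 1 - k + (n - l), _⟩
      convert hi using 2 <;> ext <;> simp <;> omega)
    simp only [Fin.mk.injEq] at this
    omega

/-- **Every `1`-cocycle is normalised**: a monotone non-injective `u : Fin 2 → ℕ` is constant and a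
`1`-cocycle vanishes on constant `1`-simplices (`iCocycles_one_constSimplex`). [cite: HatcherAT2002, §3.1 p. 198] -/
theorem isWeaklyNormalizedCochain_iCocycles_one (b : cocycles R R Y 1) :
    IsWeaklyNormalizedCochain (iCocycles R R Y 1 b) := by
  intro m τ u hu _ hinj
  obtain ⟨i, hi⟩ := exists_eq_succ_of_monotone_of_not_injective hu hinj
  obtain rfl : i = 0 := Subsingleton.elim _ _
  have hconst : (fun j : Fin 2 ↦ vtx m (u j)) = fun _ ↦ vtx m (u 0) := by
    funext j; fin_cases j
    · rfl
    · exact congrArg (vtx m) hi.symm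
  rw [hconst, compose_const, iCocycles_one_constSimplex]

/-! ### Evaluation of a cross cochain on a shuffle product, normalised factors -/

variable {p q : ℕ}

/-- The term of a single shuffle simplex in `⟨a ×' b, σ × τ⟩` vanishes unless `p = k` and the path is
straight, for normalised `a`, `b` (the monotone-label sharpening of
`crossCochain_tupleSimplex_eq_zero`). [cite: HatcherAT2002, §3.B pp. 277–280] -/
theorem crossCochain_tupleSimplex_eq_zero_of_normalized (hn : p + q = n) (hkl : k + l = n)
    (σ : SingularSimplex X p) (τ : SingularSimplex Y q) {a : SingularSimplex X k → R} {b : SingularSimplex Y l → R}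
    (ha : IsWeaklyNormalizedCochain a) (hb : IsWeaklyNormalizedCochain b)
    {w : Fin (n + 1) → V} (hw : w ∈ (shuffle n p).support) (hne : ¬(p = k ∧ w = stdPath n p)) :
    crossCochain hkl a b (tupleSimplex σ τ w) = 0 := by
  rw [crossCochain_apply, frontFace_tupleSimplex_map_fst, backFace_tupleSimplex_map_snd]
  have hbox := vertsIn_shuffle n p w hw
  have hqn : n - p = q := by omega
  by_cases hF : Function.Injective (frontLabels (show k ≤ n by omega) w)
  · by_cases hB : Function.Injective (backLabels (show l ≤ n by omega) w)
    · exact absurd (eq_stdPath_of_injective_labels hn hkl hw hF hB) hne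
    · rw [hb q τ (backLabels (show l ≤ n by omega) w) (monotone_backLabels _ hw) (fun j ↦ hqn ▸ (hbox _).2) hB,
        mul_zero]
  · rw [ha p σ (frontLabels (show k ≤ n by omega) w) (monotone_frontLabels _ hw) (fun j ↦ (hbox _).1) hF, zero_mul]

/-- **`⟨a ×' b, σ × τ⟩ = r · a(σ) b(τ)` in matched degrees** for normalised `a ∈ Cᵏ(X)`, `b ∈ Cˡ(Y)`,
`σ` a `k`-simplex, `τ` an `l`-simplex (only the straight shuffle `Rᵏ Uˡ` survives, with coefficient
`+1`). [cite: HatcherAT2002, §3.B pp. 277–280] -/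
theorem cochainEval_crossCochain_ezMap_of_normalized (hkl : k + l = n) (σ : SingularSimplex X k)
    (τ : SingularSimplex Y l) {a : SingularSimplex X k → R} {b : SingularSimplex Y l → R}
    (ha : IsWeaklyNormalizedCochain a) (hb : IsWeaklyNormalizedCochain b) (r : R) :
    cochainEval (crossCochain hkl a b) (ezMap R R n σ τ r) = r * (a σ * b τ) := by
  classical
  rw [ezMap, realize₂_eq_sum, map_finsuppSum, Finsupp.sum]
  have hmem : stdPath n k ∈ (shuffle n k).support := by
    rw [Finsupp.mem_support_iff, shuffle_apply_stdPath (by omega)]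
    exact one_ne_zero
  rw [← Finset.add_sum_erase _ _ hmem, Finset.sum_eq_zero fun w hw ↦ ?_, add_zero]
  · rw [map_zsmul, cochainEval_single, shuffle_apply_stdPath (by omega), one_smul, crossCochain_apply,
      frontFace_tupleSimplex_map_fst, backFace_tupleSimplex_map_snd]
    congr 2
    · congr 1
      conv_rhs => rw [← compose_vtx_val σ]
      congr 1; funext j; rw [frontLabels_stdPath]
    · congr 1
      conv_rhs => rw [← compose_vtx_val τ]
      congr 1; funext j; rw [backLabels_stdPath hkl]
  · obtain ⟨hne, hw'⟩ := Finset.mem_erase.mp hw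
    rw [map_zsmul, cochainEval_single,
      crossCochain_tupleSimplex_eq_zero_of_normalized hkl hkl σ τ ha hb hw' fun h ↦ hne h.2, mul_zero, smul_zero]

/-- **`⟨a ×' b, σ × τ⟩ = 0` in mismatched degrees** (`p ≠ k`, `p + q = k + l = n`) for normalised
`a`, `b` (no shuffle simplex has both a non-degenerate front `k`-face in `X` and a non-degenerate back
`l`-face in `Y`). [cite: HatcherAT2002, §3.B pp. 277–280] -/
theorem cochainEval_crossCochain_ezMap_eq_zero_of_normalized (hn : p + q = n) (hkl : k + l = n) (hpk : p ≠ k)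
    (σ : SingularSimplex X p) (τ : SingularSimplex Y q) {a : SingularSimplex X k → R} {b : SingularSimplex Y l → R}
    (ha : IsWeaklyNormalizedCochain a) (hb : IsWeaklyNormalizedCochain b) (r : R) :
    cochainEval (crossCochain hkl a b) (ezMap R R n σ τ r) = 0 := by
  classical
  rw [ezMap, realize₂_eq_sum, map_finsuppSum, Finsupp.sum]
  refine Finset.sum_eq_zero fun w hw ↦ ?_
  rw [map_zsmul, cochainEval_single,
    crossCochain_tupleSimplex_eq_zero_of_normalized hn hkl σ τ ha hb hw fun h ↦ hpk h.1, mul_zero, smul_zero]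

/-- **`⟨a ×' b, c × d⟩ = ⟨a, c⟩ · ⟨b, d⟩`** on concrete chains in matched degrees, `a`, `b` normalised.
[cite: HatcherAT2002, §3.B pp. 277–280] -/
theorem cochainEval_crossCochain_crossChain_of_normalized (hkl : k + l = n) {a : SingularSimplex X k → R}
    {b : SingularSimplex Y l → R} (ha : IsWeaklyNormalizedCochain a) (hb : IsWeaklyNormalizedCochain b)
    (c : CChain R X k) (d : CChain R Y l) :
    cochainEval (crossCochain hkl a b) (crossChain R X Y k l n c d) = cochainEval a c * cochainEval b d := by
  induction c using Finsupp.induction_linear with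
  | zero => simp
  | add c c' hc hc' => rw [map_add, LinearMap.add_apply, map_add, hc, hc', map_add, add_mul]
  | single σ r =>
    induction d using Finsupp.induction_linear with
    | zero => simp
    | add d d' hd hd' => rw [map_add, map_add, hd, hd', map_add, mul_add]
    | single τ s =>
      rw [crossChain_single_single, cochainEval_crossCochain_ezMap_of_normalized hkl σ τ ha hb, cochainEval_single,
        cochainEval_single]
      ring

/-- **`⟨a ×' b, c × d⟩ = 0`** on concrete chains in mismatched degrees (`p ≠ k`), `a`, `b` normalised.
[cite: HatcherAT2002, §3.B pp. 277–280] -/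
theorem cochainEval_crossCochain_crossChain_eq_zero_of_normalized (hn : p + q = n) (hkl : k + l = n) (hpk : p ≠ k)
    {a : SingularSimplex X k → R} {b : SingularSimplex Y l → R} (ha : IsWeaklyNormalizedCochain a)
    (hb : IsWeaklyNormalizedCochain b) (c : CChain R X p) (d : CChain R Y q) :
    cochainEval (crossCochain hkl a b) (crossChain R X Y p q n c d) = 0 := by
  induction c using Finsupp.induction_linear with
  | zero => simp
  | add c c' hc hc' => rw [map_add, LinearMap.add_apply, map_add, hc, hc', add_zero]
  | single σ r =>
    induction d using Finsupp.induction_linear with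
    | zero => simp
    | add d d' hd hd' => rw [map_add, map_add, hd, hd', add_zero]
    | single τ s =>
      rw [crossChain_single_single, cochainEval_crossCochain_ezMap_eq_zero_of_normalized hn hkl hpk σ τ ha hb]

end Normalized

/-! ### Classes with normalised representatives -/

section Classes

open singularCochainComplex

variable {R : Type v} [CommRing R]
variable {X Y : Type u} [TopologicalSpace X] [TopologicalSpace Y]
variable {k l n p q : ℕ}

/-- A cohomology class **has a normalised representative**: `α = [a]` for a cocycle `a` whose cochain
vanishes on degenerate affine reparametrisations. All classes of degree one, their pull-backs and
their cup products have one. [cite: HatcherAT2002, §3.B pp. 277–280] -/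
def HasNormalizedRep (α : singularCohomology R R X k) : Prop :=
  ∃ a : cocycles R R X k, singularCohomology.π R R X k a = α ∧ IsWeaklyNormalizedCochain (iCocycles R R X k a)

/-- **Every class of degree one has a normalised representative** (every `1`-cocycle is normalised).
[cite: HatcherAT2002, §3.1 p. 198] -/
theorem hasNormalizedRep_of_one (α : singularCohomology R R X 1) : HasNormalizedRep α := by
  induction α using singularCohomology_induction_on with
  | h a => exact ⟨a, rfl, isWeaklyNormalizedCochain_iCocycles_one a⟩

/-- The zero class has a normalised representative. [cite: HatcherAT2002, §3.1 p. 198] -/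
theorem hasNormalizedRep_zero : HasNormalizedRep (0 : singularCohomology R R X k) :=
  ⟨0, map_zero _, by rw [map_zero]; exact isWeaklyNormalizedCochain_zero⟩

/-- Sums of classes with normalised representatives have one. [cite: HatcherAT2002, §3.1 p. 198] -/
theorem HasNormalizedRep.add {α β : singularCohomology R R X k} (hα : HasNormalizedRep α) (hβ : HasNormalizedRep β) :
    HasNormalizedRep (α + β) := by
  obtain ⟨a, rfl, ha⟩ := hα
  obtain ⟨b, rfl, hb⟩ := hβ
  exact ⟨a + b, map_add _ _ _, by rw [map_add]; exact ha.add hb⟩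

/-- Scalar multiples of classes with normalised representatives have one. [cite: HatcherAT2002, §3.1 p. 198] -/
theorem HasNormalizedRep.smul {α : singularCohomology R R X k} (hα : HasNormalizedRep α) (r : R) :
    HasNormalizedRep (r • α) := by
  obtain ⟨a, rfl, ha⟩ := hα
  exact ⟨r • a, map_smul _ _ _, by rw [map_smul]; exact ha.smul r⟩

/-- **Pull-backs** of classes with normalised representatives have normalised representatives.
[cite: HatcherAT2002, §3.1 p. 198] -/
theorem HasNormalizedRep.map (f : C(X, Y)) {β : singularCohomology R R Y k} (hβ : HasNormalizedRep β) :
    HasNormalizedRep (singularCohomology.map R R f k β) := by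
  obtain ⟨b, rfl, hb⟩ := hβ
  refine ⟨cocyclesMap R R f k b, (singularCohomology.map_π f b).symm, ?_⟩
  rw [iCocycles_cocyclesMap]
  exact hb.comap f

/-- **Cup products** of classes with normalised representatives have normalised representatives.
[cite: HatcherAT2002, §3.2 p. 206] -/
theorem HasNormalizedRep.cupProduct (h : k + l = n) {α : singularCohomology R R X k} {β : singularCohomology R R X l}
    (hα : HasNormalizedRep α) (hβ : HasNormalizedRep β) : HasNormalizedRep (cupProduct h α β) := by
  obtain ⟨a, rfl, ha⟩ := hα
  obtain ⟨b, rfl, hb⟩ := hβ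
  refine ⟨cocyclesCup h a b, (cupProduct_π_π h a b).symm, ?_⟩
  rw [iCocycles_cocyclesCup]
  exact ha.cochainCup h hb

/-- **`⟨pr₁^*α ⌣ pr₂^*β, x × y⟩ = ⟨α, x⟩ · ⟨β, y⟩` in all matched degrees** (`α ∈ Hᵖ(X; R)`,
`β ∈ H_q(Y; R)` with normalised representatives — e.g. any cup monomials of degree-one classes —,
`x ∈ Hₚ(X; R)`, `y ∈ H_q(Y; R)`, `p + q = n`): the Kronecker duality of the cohomology and homology
cross products (Hatcher 2002, §3.B p. 279, "`(φ × ψ)(eᵢ × eⱼ) = φ(eᵢ)ψ(eⱼ)`"; §3.2 p. 219,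
`a × b = p₁^* a ⌣ p₂^* b`), the evaluation rule used in Lange's proof of Lemma 2.5.12.
[cite: HatcherAT2002, §3.B pp. 277–280] [cite: Lange2023AbelianVarietiesComplex, §2.5.3 Lemma 2.5.12 (proof, p. 133)] -/
theorem kroneckerPairing_cupProduct_cross_of_hasNormalizedRep (h : p + q = n) {α : singularCohomology R R X p}
    {β : singularCohomology R R Y q} (hα : HasNormalizedRep α) (hβ : HasNormalizedRep β)
    (x : singularHomology R R X p) (y : singularHomology R R Y q) :
    kroneckerPairing R R (X × Y) n
        (cupProduct h (singularCohomology.map R R (ContinuousMap.fst : C(X × Y, X)) p α)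
          (singularCohomology.map R R (ContinuousMap.snd : C(X × Y, Y)) q β))
        (singularHomology.cross R X Y h x y) =
      kroneckerPairing R R X p α x * kroneckerPairing R R Y q β y := by
  obtain ⟨a, rfl, ha⟩ := hα
  obtain ⟨b, rfl, hb⟩ := hβ
  obtain ⟨c, hc, rfl⟩ := exists_eq_homologyCls_comp x
  obtain ⟨d, hd, rfl⟩ := exists_eq_homologyCls_comp y
  rw [singularCohomology.map_π, singularCohomology.map_π, cupProduct_π_π,
    singularHomology.cross_homologyCls_homologyCls h c d hc hd,
    kroneckerPairing_π_homologyCls_comp _ _ (d_crossChain_eq_zero h c d hc hd),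
    kroneckerPairing_π_homologyCls_comp a c hc, kroneckerPairing_π_homologyCls_comp b d hd,
    iCocycles_cocyclesCup_fst_snd, cochainEval_crossCochain_crossChain_of_normalized h ha hb]

/-- **`⟨pr₁^*α ⌣ pr₂^*β, x × y⟩ = 0` in mismatched degrees** (`α ∈ Hᵏ(X; R)`, `β ∈ Hˡ(Y; R)` with
normalised representatives, `x ∈ Hₚ(X; R)`, `y ∈ H_q(Y; R)`, `k + l = p + q = n`, `p ≠ k`) — the
vanishing "by Fubini's Theorem" of the cross terms in Lange's proof of Lemma 2.5.12 (p. 133).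
[cite: Lange2023AbelianVarietiesComplex, §2.5.3 Lemma 2.5.12 (proof, p. 133)] [cite: HatcherAT2002, §3.B pp. 277–280] -/
theorem kroneckerPairing_cupProduct_cross_eq_zero_of_ne (hn : p + q = n) (hkl : k + l = n) (hpk : p ≠ k)
    {α : singularCohomology R R X k} {β : singularCohomology R R Y l} (hα : HasNormalizedRep α)
    (hβ : HasNormalizedRep β) (x : singularHomology R R X p) (y : singularHomology R R Y q) :
    kroneckerPairing R R (X × Y) n
        (cupProduct hkl (singularCohomology.map R R (ContinuousMap.fst : C(X × Y, X)) k α)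
          (singularCohomology.map R R (ContinuousMap.snd : C(X × Y, Y)) l β))
        (singularHomology.cross R X Y hn x y) = 0 := by
  obtain ⟨a, rfl, ha⟩ := hα
  obtain ⟨b, rfl, hb⟩ := hβ
  obtain ⟨c, hc, rfl⟩ := exists_eq_homologyCls_comp x
  obtain ⟨d, hd, rfl⟩ := exists_eq_homologyCls_comp y
  rw [singularCohomology.map_π, singularCohomology.map_π, cupProduct_π_π,
    singularHomology.cross_homologyCls_homologyCls hn c d hc hd,
    kroneckerPairing_π_homologyCls_comp _ _ (d_crossChain_eq_zero hn c d hc hd),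
    iCocycles_cocyclesCup_fst_snd, cochainEval_crossCochain_crossChain_eq_zero_of_normalized hn hkl hpk ha hb]

end Classes

end Literature.AlgebraicTopology.SingularHomology

end
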